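import Summits.CriticalPhenomena.CardyFormulaZ2.Theorems.CardyBoundaryCoulombGasHalfPlaneMarkDensityLawBoxExhaustionPart5
import Mathlib.Analysis.SpecialFunctions.Pow.Real
import Mathlib.Analysis.SpecialFunctions.Sqrt

/-!
# Line `Sketch` — rigidity lemmas (crux `HalfPlaneMarkDensityLaw`, stmt-CriticalPhenomena-5661)

Small analytic inputs of the rigidity theorem (file `…Rigidity`): the difference quotient
`G(t q)/t → q` of the Schwarz–Christoffel boundary map at `0`, convergence of the four lattice marks,
the cross-ratio of a symmetric prevertex tuple and a symmetric tuple in `[-1/4, 1/4]` with PRESCRIBED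
cross-ratio `x₀ ∈ (0,1)` (registered stub `stub_rigidityTuple`), mark inequalities at mesh `t/n`.
-/

noncomputable section

namespace Summit.CriticalPhenomena.CardyFormulaZ2.Cruxes.HalfPlaneMarkDensityLaw.SketchLine

open Set Metric Filter
open Literature.Probability.RandomPlanarGeometry
open scoped Topology

namespace Rigidity


/-! ## Small analytic lemmas -/

/-- Difference quotient: `G(t q)/t → q` as `t → 0⁺` when `G 0 = 0`, `G'(0) = 1`. [folklore] -/
theorem tendsto_div_of_hasDerivAt {G : ℝ → ℝ} (hG0 : G 0 = 0) (hGd : HasDerivAt G 1 0) (q : ℝ) :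
    Tendsto (fun t : ℝ ↦ G (t * q) / t) (𝓝[>] 0) (𝓝 q) := by
  by_cases hq : q = 0
  · have : (fun t : ℝ ↦ G (t * q) / t) = fun _ ↦ 0 := by
      funext t; rw [hq, mul_zero, hG0, zero_div]
    rw [this, hq]
    exact tendsto_const_nhds
  · have hs := hGd.tendsto_slope_zero
    simp only [zero_add, hG0, sub_zero, smul_eq_mul] at hs
    have hin : Tendsto (fun t : ℝ ↦ t * q) (𝓝[>] 0) (𝓝[≠] 0) := by
      refine tendsto_nhdsWithin_iff.2 ⟨?_, ?_⟩
      · have : Tendsto (fun t : ℝ ↦ t * q) (𝓝 0) (𝓝 (0 * q)) := tendsto_id.mul_const q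
        rw [zero_mul] at this
        exact this.mono_left nhdsWithin_le_nhds
      · filter_upwards [self_mem_nhdsWithin] with t ht
        exact mul_ne_zero (ne_of_gt ht) hq
    have h2 : Tendsto (fun t : ℝ ↦ (t * q)⁻¹ * G (t * q) * q) (𝓝[>] 0) (𝓝 (1 * q)) :=
      (hs.comp hin).mul_const q
    rw [one_mul] at h2
    refine h2.congr' ?_
    filter_upwards [self_mem_nhdsWithin] with t ht
    have ht0 : (t : ℝ) ≠ 0 := ne_of_gt ht
    field_simp

/-- The four lattice marks `mᵢ(t) + εᵢ = G(t pᵢ)/t + εᵢ` converge to `pᵢ + εᵢ` as `t → 0⁺`. [folklore] -/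
theorem tendsto_marks {G : ℝ → ℝ} (hG0 : G 0 = 0) (hGd : HasDerivAt G 1 0) (p : Fin 4 → ℝ)
    (ε₀ ε₂ : ℝ) :
    Tendsto (fun t : ℝ ↦ (![G (t * p 0) / t + ε₀, G (t * p 1) / t, G (t * p 2) / t + ε₂, G (t * p 3) / t]
      : Fin 4 → ℝ)) (𝓝[>] 0) (𝓝 ![p 0 + ε₀, p 1, p 2 + ε₂, p 3]) :=
  ((tendsto_div_of_hasDerivAt hG0 hGd (p 0)).add_const ε₀).matrixVecCons
    ((tendsto_div_of_hasDerivAt hG0 hGd (p 1)).matrixVecCons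
      (((tendsto_div_of_hasDerivAt hG0 hGd (p 2)).add_const ε₂).matrixVecCons
        ((tendsto_div_of_hasDerivAt hG0 hGd (p 3)).matrixVecCons tendsto_const_nhds)))

/-- The cross-ratio of a symmetric tuple `(−s, −g, g, s)`. [folklore] -/
theorem crossRatio_symm (s g : ℝ) :
    crossRatio ![-s, -g, g, s] = ((s - g) / (s + g)) ^ 2 := by
  simp only [crossRatio, Matrix.cons_val_zero, Matrix.cons_val_one, Matrix.cons_val]
  rw [div_pow]
  congr 1 <;> ring

/-- A symmetric prevertex tuple in `(−1/2, 1/2)` with prescribed cross-ratio `x₀ ∈ (0,1)`: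
`p = (−1/4, −g, g, 1/4)`, `g = (1 − √x₀)/(4 (1 + √x₀))`. [folklore] -/
theorem exists_tuple {x₀ : ℝ} (hx : x₀ ∈ Ioo (0 : ℝ) 1) :
    ∃ p : Fin 4 → ℝ, StrictMono p ∧ (∀ i, |p i| ≤ 1 / 4) ∧ crossRatio p = x₀ := by
  set r := Real.sqrt x₀ with hr
  have hr0 : 0 < r := Real.sqrt_pos.2 hx.1
  have hr1 : r < 1 := by rw [hr, Real.sqrt_lt' one_pos]; simpa using hx.2
  set g : ℝ := 1 / 4 * ((1 - r) / (1 + r)) with hg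
  have hq0 : 0 < (1 - r) / (1 + r) := div_pos (by linarith) (by linarith)
  have hq1 : (1 - r) / (1 + r) < 1 := by rw [div_lt_one (by linarith)]; linarith
  have hg0 : 0 < g := by rw [hg]; positivity
  have hg1 : g < 1 / 4 := by rw [hg]; nlinarith
  refine ⟨![-(1 / 4), -g, g, 1 / 4], ?_, ?_, ?_⟩
  · refine Fin.strictMono_iff_lt_succ.2 fun i ↦ ?_
    fin_cases i <;> simp <;> linarith
  · intro i
    fin_cases i <;> simp [abs_le] <;> constructor <;> linarith
  · rw [crossRatio_symm]
    have e : (1 / 4 - g) / (1 / 4 + g) = r := by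
      rw [hg]; field_simp; ring
    rw [e, hr, Real.sq_sqrt hx.1.le]

/-- Mark inequalities at mesh `t/n ≤ t`: `|x| < 3` and `4t ≤ K` give `t x ± t/n ∈ (-K, K)`. [folklore] -/
theorem mark_ineq {K t x : ℝ} {n : ℕ} (ht : 0 < t) (htK : 4 * t ≤ K) (hx : |x| < 3) (hn : 1 ≤ n) :
    -K < t * x - t / n ∧ t * x + t / n < K := by
  have hnr : (1 : ℝ) ≤ n := by exact_mod_cast hn
  have hδt : t / n ≤ t := div_le_self ht.le hnr
  have hδ0 : 0 < t / n := div_pos ht (by linarith)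
  have h1 : |t * x| < t * 3 := by
    rw [abs_mul, abs_of_pos ht]; exact mul_lt_mul_of_pos_left hx ht
  have h2 := neg_abs_le (t * x)
  have h3 := le_abs_self (t * x)
  constructor <;> linarith

/-- `![m 0, m 1, m 2, m 3] = m`. [folklore] -/
theorem vec4_eta (m : Fin 4 → ℝ) : ![m 0, m 1, m 2, m 3] = m := by
  funext i; fin_cases i <;> rfl

end Rigidity

/-- Registered stub `stub_rigidityTuple` of this support file: every `x₀ ∈ (0,1)` is the cross-ratio
of a strictly increasing real quadruple in `[-1/4, 1/4]` (so that all its dilates by `t ∈ (0,1]` are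
admissible prevertex tuples of the Schwarz–Christoffel box). [folklore] -/
theorem stub_rigidityTuple :
    ∀ x₀ : ℝ, x₀ ∈ Set.Ioo (0 : ℝ) 1 → ∃ p : Fin 4 → ℝ, StrictMono p ∧ (∀ i, |p i| ≤ 1 / 4) ∧
      Literature.Probability.RandomPlanarGeometry.crossRatio p = x₀ :=
  fun _ hx ↦ Rigidity.exists_tuple hx

end Summit.CriticalPhenomena.CardyFormulaZ2.Cruxes.HalfPlaneMarkDensityLaw.SketchLine

end
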